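import Summits.Langlands.Langlands.Theses.SenNullAlignment
import Literature.NumberTheory.Automorphic.HilbertModularLocalGlobal
import Literature.NumberTheory.GaloisRepresentations.LocalArtinMapUnique
import Literature.NumberTheory.GaloisRepresentations.LocalArtinMapPinned

/-!
# Sketch — first lemmas of the crux ideas for `RegularServed` (stmt-Langlands-16306), round 1, ideator 1

Three levers for the ONLY non-literature delta of the crux (refuter rattack-16306: the pins
`llc_isCanonical` / `llc_eps_isCanonical` of `ReciprocityData`, versus the bare `∃ llc` of the
named fact `galoisRep_GL2_totallyReal_localGlobal`):

* A `pinned-recitation` — the printed theorem IS pinned (Skinner 2009 p. 242; Harris–Taylor 2001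
  pp. 3–4): the sharpened fact `GaloisRepGL2TotallyRealLocalGlobalPinned`, and the PROOF that it plus
  the two in-print stubs of `Lines/birth.lean` gives the crux (`regularServed_of_pinned`).
* B `twist-probe-self-pinning` — the unpinned fact pins its own level-`K_v` Artin datum
  (`ArtinPinOfServesRegular`), by twisting served `π` with globalised finite-order characters.
* C `epsilon-artin-rigidity` — Deligne's axioms police the Artin data: `EpsilonArtinRigidity`, and the
  PROOF that it makes both pins theorems about `LocalLanglandsDatum` (`pins_of_epsilonArtinRigidity`),
  whence the crux from the UNPINNED fact (`regularServed_of_rigidity`).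
-/

noncomputable section

set_option linter.dupNamespace false

namespace Summit.Langlands.Langlands.Cruxes.RegularServed.Ideas

open scoped MatrixGroups Matrix NumberField
open NumberField IsDedekindDomain Filter
open Literature.NumberTheory.Automorphic Literature.NumberTheory.GaloisRepresentations
open Summit.Langlands
open Summit.Langlands.Langlands.Theses.SenNullAlignment (RegularServed)

/-! ## 0. The fact's clauses with the family `llc` as a parameter -/

/-- The local–global clauses of `galoisRep_GL2_totallyReal_localGlobal` for a GIVEN family `llc`
(the fact is literally `∀ K, IsTotallyReal K → ∃ llc, ServesRegular K llc`,
`galoisRep_GL2_totallyReal_localGlobal_iff_servesRegular`). [folklore] -/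
def ServesRegular (K : Type) [Field K] [NumberField K]
    (llc : ∀ v : HeightOneSpectrum (𝓞 K), LocalLanglandsDatum (v.adicCompletion K)) : Prop :=
  ∀ (hcpt : isCompact_glFiniteIntegralLevel 2 K) (π : CuspidalAutomorphicRepData 2 K hcpt),
    π.1.IsLAlgebraic → (∃ T : InfinityType K 2, π.1.HasInfinityType T ∧ T.IsRegular) →
    ∀ (ℓ : ℕ) [Fact ℓ.Prime] (ι : PadicAlgCl ℓ ≃+* ℂ) (r : FramedGaloisRep K (PadicAlgCl ℓ) 2),
      r.toGaloisRep.IsIrreducible → SatakeFrobCompatibleAE ι π.1 r →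
      (∀ (v : HeightOneSpectrum (𝓞 K)) (hv : ((ℓ : ℕ) : 𝓞 K) ∈ v.asIdeal),
          (Literature.NumberTheory.PAdicHodge.fontainePstAdicCompletion v ℓ hv).IsDeRhamFramed (r.toLocal v)) ∧
      ∀ v : HeightOneSpectrum (𝓞 K),
        ∃ (πv : SmoothIrrep (GL (Fin 2) (v.adicCompletion K)))
          (rv : WeilDeligneRep (v.adicCompletion K) (PadicAlgCl ℓ) (Fin 2 → PadicAlgCl ℓ))
          (rℂ : WeilDeligneRep (v.adicCompletion K) ℂ (Fin 2 → ℂ)),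
          π.1.HasLocalComponentAt v πv.ρ ∧
          (((ℓ : ℕ) : 𝓞 K) ∉ v.asIdeal →
            IsWeilDeligneOfLadic (r.toLocal v).toWeilGroupHom rv) ∧
          (∀ hv : ((ℓ : ℕ) : 𝓞 K) ∈ v.asIdeal,
            (Literature.NumberTheory.PAdicHodge.fontainePstAdicCompletion v ℓ hv).IsWeilDeligneOf (r.toLocal v) rv) ∧
          rv.IsTransportAlong (ι : PadicAlgCl ℓ →+* ℂ) rℂ ∧
          rℂ.HasFrobSemisimpleClass ((llc v).recGL 2 (IrrClass.mk πv))

/-- The named fact, rewritten with `ServesRegular` (by `Iff.rfl`). [folklore] -/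
theorem galoisRep_GL2_totallyReal_localGlobal_iff_servesRegular :
    galoisRep_GL2_totallyReal_localGlobal ↔
      ∀ (K : Type) [Field K] [NumberField K], IsTotallyReal K →
        ∃ llc : ∀ v : HeightOneSpectrum (𝓞 K), LocalLanglandsDatum (v.adicCompletion K),
          ServesRegular K llc :=
  Iff.rfl

/-- The two pins of `Summit.Langlands.ReciprocityData` for a family `llc`. [folklore] -/
def IsPinned {K : Type} [Field K] [NumberField K]
    (llc : ∀ v : HeightOneSpectrum (𝓞 K), LocalLanglandsDatum (v.adicCompletion K)) : Prop :=
  (∀ v : HeightOneSpectrum (𝓞 K), (llc v).artin.IsCanonical) ∧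
    ∀ (v : HeightOneSpectrum (𝓞 K)) (E : Type) [Field E] [ValuativeRel E] [TopologicalSpace E]
      [IsNonarchimedeanLocalField E] [Algebra (v.adicCompletion K) E]
      [FiniteDimensional (v.adicCompletion K) E], ((llc v).eps.artin E).IsCanonical

/-- A pinned family IS a reciprocity datum. [folklore] -/
def reciprocityDataOfPinned {K : Type} [Field K] [NumberField K]
    (llc : ∀ v : HeightOneSpectrum (𝓞 K), LocalLanglandsDatum (v.adicCompletion K))
    (h : IsPinned llc) : ReciprocityData K :=
  ⟨llc, h.1, h.2⟩

/-! ## The two in-print stubs of `Lines/birth.lean` (existence, Ribet), as named statements -/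

/-- Statement of `stub_exists_attached_GL2_regular` of `Lines/birth.lean`, verbatim. [folklore] -/
def ExistsAttachedGL2Regular : Prop :=
  ∀ (K : Type) [Field K] [NumberField K], NumberField.IsTotallyReal K →
    ∀ (hcpt : Literature.NumberTheory.Automorphic.isCompact_glFiniteIntegralLevel 2 K)
      (π : Literature.NumberTheory.Automorphic.CuspidalAutomorphicRepData 2 K hcpt),
      π.1.IsLAlgebraic →
      (∃ T : Literature.NumberTheory.Automorphic.InfinityType K 2,
        π.1.HasInfinityType T ∧ T.IsRegular) →
      ∀ (ℓ : ℕ) [Fact ℓ.Prime] (ι : PadicAlgCl ℓ ≃+* ℂ),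
        ∃ ρ : Literature.NumberTheory.GaloisRepresentations.FramedGaloisRep K (PadicAlgCl ℓ) 2,
          ∀ᶠ v : IsDedekindDomain.HeightOneSpectrum (NumberField.RingOfIntegers K) in
            Filter.cofinite, Summit.Langlands.SatakeFrobCompatibleAt ι π.1 ρ v

/-- Statement of `stub_irreducible_of_attached_GL2_regular` of `Lines/birth.lean`, verbatim.
[folklore] -/
def IrreducibleOfAttachedGL2Regular : Prop :=
  ∀ (K : Type) [Field K] [NumberField K], NumberField.IsTotallyReal K →
    ∀ (hcpt : Literature.NumberTheory.Automorphic.isCompact_glFiniteIntegralLevel 2 K)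
      (π : Literature.NumberTheory.Automorphic.CuspidalAutomorphicRepData 2 K hcpt),
      π.1.IsLAlgebraic →
      (∃ T : Literature.NumberTheory.Automorphic.InfinityType K 2,
        π.1.HasInfinityType T ∧ T.IsRegular) →
      ∀ (ℓ : ℕ) [Fact ℓ.Prime] (ι : PadicAlgCl ℓ ≃+* ℂ)
        (ρ : Literature.NumberTheory.GaloisRepresentations.FramedGaloisRep K (PadicAlgCl ℓ) 2),
        (∀ᶠ v : IsDedekindDomain.HeightOneSpectrum (NumberField.RingOfIntegers K) in
            Filter.cofinite, Summit.Langlands.SatakeFrobCompatibleAt ι π.1 ρ v) →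
        ρ.toGaloisRep.IsIrreducible

/-- **The seam shared by all three cards**: a PINNED family serving the regular sector gives the
crux, given existence and Ribet (stubs 1–2 of the birth line).  Pure packaging: `RD := ⟨llc, pins⟩`,
`RD.pst = fontainePstAdicCompletion` and `LocalGlobalCompatibleAt RD … v` = the fact's clause by
`rfl`. [folklore] -/
theorem regularServed_of_isPinned_servesRegular (h₁ : ExistsAttachedGL2Regular)
    (h₂ : IrreducibleOfAttachedGL2Regular)
    (hP : ∀ (K : Type) [Field K] [NumberField K], IsTotallyReal K →
      ∃ llc : ∀ v : HeightOneSpectrum (𝓞 K), LocalLanglandsDatum (v.adicCompletion K),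
        IsPinned llc ∧ ServesRegular K llc) :
    RegularServed := by
  intro K _ _ hK
  obtain ⟨llc, hpin, hserve⟩ := hP K hK
  refine ⟨reciprocityDataOfPinned llc hpin, ?_⟩
  intro hcpt π hL hreg ℓ _ ι
  obtain ⟨ρ, hae⟩ := h₁ K hK hcpt π hL hreg ℓ ι
  have hirr : ρ.toGaloisRep.IsIrreducible := h₂ K hK hcpt π hL hreg ℓ ι ρ hae
  obtain ⟨hdR, hlgc⟩ := hserve hcpt π hL hreg ℓ ι ρ hirr hae
  refine ⟨ρ, hirr, ⟨hae.mono fun v hv => ?_, hdR⟩, hae, fun v => hlgc v⟩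
  obtain ⟨α, -, hur, -⟩ := hv
  exact hur

/-! ## Card A — `pinned-recitation`: the sharpened (faithful) fact and the crux from it -/

/-- **Card A, first lemma (the sharpened named fact).**  Skinner 2009 (1) p. 242 + Thm. 1, Carayol
1986, Taylor 1989, Blasius–Rogawski 1993, for Harris–Taylor's `rec_v` — which in print is normalised
against THE Artin map of local class field theory ("We choose `Rec_v` so that when `n = 1`, `Rec_v` is
the inverse of the Artin map of local class field theory normalized so that uniformizers correspond
to geometric frobenius", Skinner p. 242; `rec_K(π) = π ∘ Art_K⁻¹` for the CANONICAL `Art_K`,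
Harris–Taylor pp. 3–4) and against Deligne's local constants (defined for THE Artin maps, Deligne
1973 Thm. 4.1 / Tate 1979 (3.4.1)): the family may be taken PINNED.
[cite: Skinner2009, (1) p. 242 and Thm. 1] [cite: HarrisTaylorAMS2001, Thm. A and pp. 3–4] -/
def GaloisRepGL2TotallyRealLocalGlobalPinned : Prop :=
  ∀ (K : Type) [Field K] [NumberField K], IsTotallyReal K →
    ∃ llc : ∀ v : HeightOneSpectrum (𝓞 K), LocalLanglandsDatum (v.adicCompletion K),
      IsPinned llc ∧ ServesRegular K llc

/-- The sharpened fact implies the tree's fact (lower bound: nothing is lost). [folklore] -/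
theorem galoisRep_GL2_totallyReal_localGlobal_of_pinned
    (h : GaloisRepGL2TotallyRealLocalGlobalPinned) : galoisRep_GL2_totallyReal_localGlobal :=
  fun K _ _ hK => let ⟨llc, _, hs⟩ := h K hK; ⟨llc, hs⟩

/-- **Card A closes the crux**: pinned fact + existence + Ribet ⇒ `RegularServed`. [folklore] -/
theorem regularServed_of_pinned (h₁ : ExistsAttachedGL2Regular)
    (h₂ : IrreducibleOfAttachedGL2Regular) (hP : GaloisRepGL2TotallyRealLocalGlobalPinned) :
    RegularServed :=
  regularServed_of_isPinned_servesRegular h₁ h₂ hP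

/-! ## Card B — `twist-probe-self-pinning`: the fact pins its own Artin datum -/

/-- **Card B, first lemma (pin 1 is forced)**: ANY family `llc` witnessing the unpinned fact over a
totally real `K` has, at every completion, THE canonical Artin map.  Mechanism: compare the fact's
clause for `π` and for `π ⊗ (χ ∘ det)` (`CuspidalAutomorphicRepData.twist`,
`hasLocalComponentAt_twist`, `eventually_hasSatakeParamAt_twist`, all proved) through the twist
clause `IsLocalLanglandsGL.twist`, Chebotarev rigidity
(`FramedGaloisRep.nonempty_equiv_of_hasFrobCharpolyAt_eventually`) and GL₁ local–global class field
theory (`artinCharacter_localGlobalCompatible_holds`): the character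
`(χ_v ∘ (llc v).artin) · (χ_v ∘ Art_v)⁻¹` is absorbed by `WD(ρ_π|_v)`, hence trivial for one `π`
unramified at `v` with `a_v(π) ≠ 0`; globalisable finite-order `χ_v` (Grunwald–Wang) separate
`K_vˣ`. [cite: HarrisTaylorAMS2001, Thm. A (iv)] [cite: NeukirchANT1999, Ch. VI Prop. (5.6)] -/
def ArtinPinOfServesRegular : Prop :=
  ∀ (K : Type) [Field K] [NumberField K], IsTotallyReal K →
    ∀ llc : ∀ v : HeightOneSpectrum (𝓞 K), LocalLanglandsDatum (v.adicCompletion K),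
      ServesRegular K llc → ∀ v : HeightOneSpectrum (𝓞 K), (llc v).artin.IsCanonical

/-- **Card B, second lemma (transfer to a pinned frame on the classes the crux reads)**: if `llc`
serves the regular sector and has canonical Artin maps, then EVERY pinned family whose `rec₂` agrees
with `llc`'s on the local components of served `π` serves the regular sector too — trivially, since
the datum enters `ServesRegular` only through `recGL 2` on those classes.  The content of Card B is
the agreement hypothesis `hagree` (generic-class cross-rigidity: `L`-factor clause on non-supercuspidal
classes, CM calibration + the `GL(2)` converse theorem on dihedral supercuspidal classes; residue:
primitive classes at dyadic places). [folklore] -/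
theorem servesRegular_of_recGL_two_agree {K : Type} [Field K] [NumberField K]
    (llc llc' : ∀ v : HeightOneSpectrum (𝓞 K), LocalLanglandsDatum (v.adicCompletion K))
    (hagree : ∀ (v : HeightOneSpectrum (𝓞 K)) (hcpt : isCompact_glFiniteIntegralLevel 2 K)
      (π : CuspidalAutomorphicRepData 2 K hcpt) (πv : SmoothIrrep (GL (Fin 2) (v.adicCompletion K))),
      π.1.HasLocalComponentAt v πv.ρ →
        (llc' v).recGL 2 (IrrClass.mk πv) = (llc v).recGL 2 (IrrClass.mk πv))
    (h : ServesRegular K llc) : ServesRegular K llc' := by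
  intro hcpt π hL hreg ℓ _ ι r hirr hae
  obtain ⟨hdR, hlgc⟩ := h hcpt π hL hreg ℓ ι r hirr hae
  refine ⟨hdR, fun v => ?_⟩
  obtain ⟨πv, rv, rℂ, hloc, h1, h2, h3, h4⟩ := hlgc v
  exact ⟨πv, rv, rℂ, hloc, h1, h2, h3, by rw [hagree v hcpt π πv hloc]; exact h4⟩

/-! ## Card C — `epsilon-artin-rigidity`: Deligne's axioms police the Artin data -/

/-- **Card C, the lever as a statement**: over a non-archimedean local field `F`, the local Artin
data of ANY system of local constants (Deligne's axioms as typed in `LocalEpsilonSystem`) satisfy the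
five characterising clauses `IsLocalArtinMap` at every finite extension — i.e. an `ε`-system can only
be normalised against THE reciprocity maps.  (Conjectural converse to Deligne 1973 Thm. 4.1; first
checkable consequence of the axioms: transfer-compatibility `a_E ∘ Ver = a_F` from `addChar_shift` +
`induction_degree_zero`.) [cite: Deligne1973, Thm. 4.1] -/
def EpsilonArtinRigidity (F : Type) [Field F] [ValuativeRel F] [TopologicalSpace F]
    [IsNonarchimedeanLocalField F] : Prop :=
  ∀ (𝓔 : LocalEpsilonSystem F) (E : Type) [Field E] [ValuativeRel E] [TopologicalSpace E]
    [IsNonarchimedeanLocalField E] [Algebra F E] [FiniteDimensional F E],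
    IsLocalArtinMap E (𝓔.artin E).artin

/-- **Card C makes both pins theorems about the datum type**: under `EpsilonArtinRigidity F`, every
`L : LocalLanglandsDatum F` is Henniart-normalised — its `ε`-system's Artin data are canonical at
every `E` (uniqueness of the Artin map, PROVED: `IsLocalArtinMap.unique_holds`), and so is `L.artin`
itself (`L.eps_artin : L.eps.artin F = L.artin`). [folklore] -/
theorem pins_of_epsilonArtinRigidity {F : Type} [Field F] [ValuativeRel F] [TopologicalSpace F]
    [IsNonarchimedeanLocalField F] (hrig : EpsilonArtinRigidity F) (L : LocalLanglandsDatum F) :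
    L.artin.IsCanonical ∧
      ∀ (E : Type) [Field E] [ValuativeRel E] [TopologicalSpace E] [IsNonarchimedeanLocalField E]
        [Algebra F E] [FiniteDimensional F E], (L.eps.artin E).IsCanonical := by
  have hE : ∀ (E : Type) [Field E] [ValuativeRel E] [TopologicalSpace E]
      [IsNonarchimedeanLocalField E] [Algebra F E] [FiniteDimensional F E],
      (L.eps.artin E).IsCanonical :=
    fun E _ _ _ _ _ _ =>
      LocalArtinData.isCanonical_of_unique (IsLocalArtinMap.unique_holds E) (hrig L.eps E)
  refine ⟨?_, hE⟩
  have h := hE F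
  rwa [L.eps_artin] at h

/-- **Card C closes the crux from the UNPINNED fact**: rigidity at every completion + the tree's
fact `galoisRep_GL2_totallyReal_localGlobal` + existence + Ribet ⇒ `RegularServed` (the grounder's
original 12-line packaging `RD := ⟨llc⟩`, now legal). [folklore] -/
theorem regularServed_of_rigidity (h₁ : ExistsAttachedGL2Regular)
    (h₂ : IrreducibleOfAttachedGL2Regular) (hLG : galoisRep_GL2_totallyReal_localGlobal)
    (hrig : ∀ (K : Type) [Field K] [NumberField K] (v : HeightOneSpectrum (𝓞 K)),
      EpsilonArtinRigidity (v.adicCompletion K)) :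
    RegularServed := by
  refine regularServed_of_isPinned_servesRegular h₁ h₂ fun K _ _ hK => ?_
  obtain ⟨llc, hs⟩ := hLG K hK
  exact ⟨llc, ⟨fun v => (pins_of_epsilonArtinRigidity (hrig K v) (llc v)).1,
    fun v E _ _ _ _ _ _ => (pins_of_epsilonArtinRigidity (hrig K v) (llc v)).2 E⟩, hs⟩

/-- **Cards B + (A at dyadic primitive classes | C)**: pin 1 from `ArtinPinOfServesRegular` is what a
transfer to ANY pinned family needs first (the agreement hypothesis of
`servesRegular_of_recGL_two_agree` is false for data with different Artin maps). [folklore] -/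
theorem isCanonical_of_servesRegular (hB : ArtinPinOfServesRegular) {K : Type} [Field K]
    [NumberField K] (hK : IsTotallyReal K)
    (llc : ∀ v : HeightOneSpectrum (𝓞 K), LocalLanglandsDatum (v.adicCompletion K))
    (h : ServesRegular K llc) (v : HeightOneSpectrum (𝓞 K)) : (llc v).artin.IsCanonical :=
  hB K hK llc h v

end Summit.Langlands.Langlands.Cruxes.RegularServed.Ideas

end
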